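/-
Copyright (c) 2026 the pub-hodgecm-mathlib formalisation cell (harness21).  Prover seat hodgecm-mathlib-F0P3a-p04 (g19): road «S3-ram» (LEAD F0P3a-plan (g12∕g13); junction
pen F0P3a-p01 (g17), J-PACK v2 assembly lemma L3; owner F0P3a-p06 (g15)); 2026-09-02.
-/
import Literature.NumberTheory.Automorphic.UnitaryLatticeTreeFixedRowLeafRamified        -- ★ ROW-C (F0P2-p01)
import Literature.NumberTheory.Automorphic.UnitaryLatticeTreeFixedRowRegularRamified     -- ★ ROW-R (F0P3-p03)
import Literature.NumberTheory.Automorphic.UnitaryLatticeTreeFixedRowEvenRamified        -- ★ ROW-E (F0P2-p01)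
import Literature.NumberTheory.Automorphic.UnitaryLatticeTreeEvenDepthRankRamified       -- ★ I «even depth ⇒ rank 2» (F0P2-p01)
import Literature.NumberTheory.Automorphic.UnitaryLatticeTreeNilpotencyTokenOfDepths     -- ★ ROW-N (F0P3-p03)
import Literature.NumberTheory.Automorphic.UnitaryLatticeTreeEigenframeCharpoly          -- ★ `charpoly_of_eigenframe` (A-p16)
import Literature.NumberTheory.Automorphic.UnitaryLatticeTreeSelfDualTransitiveTame      -- ★ `exists_latticeGraphIso_root_eq_of_v_two`
import HarnessLib

/-!
# The lattice graph of a hermitian space — THE ENGINE'S LOCAL-LAW BINDERS FROM THE ★ ROWS, PART 1 (label calculus; rows `hodd`, `hC`, `hR`, `hE`)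
# (Kottwitz 1986 §3; Rogawski 1990 §4.9; Bruhat–Tits 1972 §10)

Topic `NumberTheory/Automorphic`; namespace `Literature.NumberTheory.Automorphic.UnitaryLatticeTree`.  THEOREMS ONLY (no definition, no instance, no notation, no named fact,
no `sorry`); kernel lane `--supports stmt-HodgeConjecture-24833`.  Cell `pub/hodgecm-mathlib` (D-0151), crux H413; road «S3-ram» (Literature seeding, count-neutral); the
(a2) JUNCTION of the type-(1) ramified row (pen F0P3a-p01 (g17), skeleton v7 326c2913): assembly lemma **L3 `engineRows_of_rows`** — the local-law binders
`hodd hB hC hR hE hO hP` of the ★ tree-induction engine (`strataVec_cone_eq_of_localLaw`, p847302) for the CONCRETE labels `dep ∕ rk ∕ cl` of the junction, characterised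
abstractly by `hdep` (`e ≤ dep w ↔ e ≤ B ∧ LEV[w](ϖ^e)`), `hrk` (`rk w = if LEV₂[w](ϖ^(2·dep w+1)) then 1 else 2`), `hcl` (`cl w = if CLS[w](dep w)(c₁) then 1 else −1`).
THIS FILE: §1 the LABEL CALCULUS (tokens ↔ labels; the orientation ∕ `dep < N` binder `horient` = L2's conclusion; residual nilpotency `LEV₃(ϖ^(3d+1))` at every fixed vertex
of depth `d < N` by ★ ROW-N over ★ `charpoly_of_eigenframe`), §2 the rows **`hodd`** (★ I: even depth `≥ 2` and rank one is impossible), **`hC`** (★ ROW-C), **`hR`**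
(★ ROW-R), **`hE`** (★ ROW-E), each in the engine's shape over the abstract grandchildren binder `GC` (`hGC`).  PART 2 (this seat): `hO`, `hP`, `hB` and the socket-verbatim
conjunction.

HONEST LABEL: HC_CM is proved only modulo the 2 remaining named inputs (hLiu418 24832, h413 24833) until rung 0 closes; nothing printed is asserted here (bookkeeping over
★ rows); «S3-ram» has no books consequence.

## References
* [Kottwitz1986] R. E. Kottwitz, *Base change for unit elements of Hecke algebras*, Compositio Math. 60 (1986), §3 (levels of fixed lattices; shell recursion).
* [Rogawski1990] J. D. Rogawski, *Automorphic Representations of Unitary Groups in Three Variables*, Ann. of Math. Stud. 123 (1990), §4.9 pp. 54–56.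
* [BruhatTits1972] F. Bruhat, J. Tits, *Groupes réductifs sur un corps local I*, Publ. Math. IHÉS 41 (1972), §10 (lattice models).
* [Serre1980Trees] J.-P. Serre, *Trees* (1980), Ch. II §1.1 (lattices, neighbours, levels).
-/

set_option autoImplicit false

noncomputable section

open scoped Valued WithZero Matrix MatrixGroups
open Polynomial Classical

namespace Literature.NumberTheory.Automorphic.UnitaryLatticeTree

open Literature.NumberTheory.Automorphic Literature.NumberTheory.Automorphic.HermitianLattice

variable {K : Type*} [Field K] [Valued K ℤᵐ⁰] {σ : K →+* K} {ϖ : K}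

/-! ## §1 Label calculus: tokens ↔ the abstract labels `dep`, `rk`, `cl` -/

/-- `e ≤ dep w` gives the depth token `LEV[w](ϖ^e)` at a fixed vertex. [cite: Kottwitz1986, §3] -/
theorem lev_pow_of_le_dep {γ : unitaryGroupOfForm σ ((StdForm.antidiagonal 3).over K)} {B : ℕ} {dep : {M : Submodule 𝒪[K] (Fin 3 → K) // IsVertex σ ϖ ((StdForm.antidiagonal 3).over K) M} → ℕ}
    (hdep : ∀ w : {M : Submodule 𝒪[K] (Fin 3 → K) // IsVertex σ ϖ ((StdForm.antidiagonal 3).over K) M}, latticeGraphIso σ ϖ ((StdForm.antidiagonal 3).over K) γ w = w → ∀ e, e ≤ dep w ↔ e ≤ B ∧ w.1.map ((Matrix.toLin' (((γ : GL (Fin 3) K) : Matrix (Fin 3) (Fin 3) K) - 1)).restrictScalars 𝒪[K]) ≤ scaleLattice (ϖ ^ e) w.1)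
    {w : {M : Submodule 𝒪[K] (Fin 3 → K) // IsVertex σ ϖ ((StdForm.antidiagonal 3).over K) M}} (hfix : latticeGraphIso σ ϖ ((StdForm.antidiagonal 3).over K) γ w = w) {e : ℕ} (he : e ≤ dep w) : w.1.map ((Matrix.toLin' (((γ : GL (Fin 3) K) : Matrix (Fin 3) (Fin 3) K) - 1)).restrictScalars 𝒪[K]) ≤ scaleLattice (ϖ ^ e) w.1 :=
  (((hdep w hfix e).1 he)).2

/-- `dep w < e ≤ B` gives `¬ LEV[w](ϖ^e)` at a fixed vertex. [cite: Kottwitz1986, §3] -/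
theorem not_lev_pow_of_dep_lt {γ : unitaryGroupOfForm σ ((StdForm.antidiagonal 3).over K)} {B : ℕ} {dep : {M : Submodule 𝒪[K] (Fin 3 → K) // IsVertex σ ϖ ((StdForm.antidiagonal 3).over K) M} → ℕ}
    (hdep : ∀ w : {M : Submodule 𝒪[K] (Fin 3 → K) // IsVertex σ ϖ ((StdForm.antidiagonal 3).over K) M}, latticeGraphIso σ ϖ ((StdForm.antidiagonal 3).over K) γ w = w → ∀ e, e ≤ dep w ↔ e ≤ B ∧ w.1.map ((Matrix.toLin' (((γ : GL (Fin 3) K) : Matrix (Fin 3) (Fin 3) K) - 1)).restrictScalars 𝒪[K]) ≤ scaleLattice (ϖ ^ e) w.1)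
    {w : {M : Submodule 𝒪[K] (Fin 3 → K) // IsVertex σ ϖ ((StdForm.antidiagonal 3).over K) M}} (hfix : latticeGraphIso σ ϖ ((StdForm.antidiagonal 3).over K) γ w = w) {e : ℕ} (heB : e ≤ B) (he : dep w < e) : ¬ w.1.map ((Matrix.toLin' (((γ : GL (Fin 3) K) : Matrix (Fin 3) (Fin 3) K) - 1)).restrictScalars 𝒪[K]) ≤ scaleLattice (ϖ ^ e) w.1 :=
  fun h => absurd ((hdep w hfix e).2 ⟨heB, h⟩) (by omega)

/-- The depth label from the two tokens: `LEV[w](ϖ^e)`, `¬LEV[w](ϖ^(e+1))`, `e ≤ B` give `dep w = e`. [cite: Kottwitz1986, §3] -/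
theorem dep_eq_of_lev_of_not_lev {γ : unitaryGroupOfForm σ ((StdForm.antidiagonal 3).over K)} {B : ℕ} {dep : {M : Submodule 𝒪[K] (Fin 3 → K) // IsVertex σ ϖ ((StdForm.antidiagonal 3).over K) M} → ℕ}
    (hdep : ∀ w : {M : Submodule 𝒪[K] (Fin 3 → K) // IsVertex σ ϖ ((StdForm.antidiagonal 3).over K) M}, latticeGraphIso σ ϖ ((StdForm.antidiagonal 3).over K) γ w = w → ∀ e, e ≤ dep w ↔ e ≤ B ∧ w.1.map ((Matrix.toLin' (((γ : GL (Fin 3) K) : Matrix (Fin 3) (Fin 3) K) - 1)).restrictScalars 𝒪[K]) ≤ scaleLattice (ϖ ^ e) w.1)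
    {w : {M : Submodule 𝒪[K] (Fin 3 → K) // IsVertex σ ϖ ((StdForm.antidiagonal 3).over K) M}} (hfix : latticeGraphIso σ ϖ ((StdForm.antidiagonal 3).over K) γ w = w) {e : ℕ} (heB : e ≤ B) (hlev : w.1.map ((Matrix.toLin' (((γ : GL (Fin 3) K) : Matrix (Fin 3) (Fin 3) K) - 1)).restrictScalars 𝒪[K]) ≤ scaleLattice (ϖ ^ e) w.1) (hnot : ¬ w.1.map ((Matrix.toLin' (((γ : GL (Fin 3) K) : Matrix (Fin 3) (Fin 3) K) - 1)).restrictScalars 𝒪[K]) ≤ scaleLattice (ϖ ^ (e + 1)) w.1) : dep w = e := by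
  have h1 : e ≤ dep w := (hdep w hfix e).2 ⟨heB, hlev⟩
  have h2 : ¬ e + 1 ≤ dep w := fun h => hnot ((hdep w hfix (e + 1)).1 h).2
  omega

/-- The rank label: `rk w = 1 ↔ LEV₂[w](ϖ^(2·dep w+1))` and `rk w = 2 ↔ ¬ …`. [cite: Kottwitz1986, §3] -/
theorem rk_eq_one_iff_of_hrk {γ : unitaryGroupOfForm σ ((StdForm.antidiagonal 3).over K)} {dep rk : {M : Submodule 𝒪[K] (Fin 3 → K) // IsVertex σ ϖ ((StdForm.antidiagonal 3).over K) M} → ℕ}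
    (hrk : ∀ w : {M : Submodule 𝒪[K] (Fin 3 → K) // IsVertex σ ϖ ((StdForm.antidiagonal 3).over K) M}, rk w = if w.1.map ((Matrix.toLin' ((((γ : GL (Fin 3) K) : Matrix (Fin 3) (Fin 3) K) - 1) ^ 2)).restrictScalars 𝒪[K]) ≤ scaleLattice (ϖ ^ (2 * dep w + 1)) w.1 then 1 else 2) (w : {M : Submodule 𝒪[K] (Fin 3 → K) // IsVertex σ ϖ ((StdForm.antidiagonal 3).over K) M}) :
    (rk w = 1 ↔ w.1.map ((Matrix.toLin' ((((γ : GL (Fin 3) K) : Matrix (Fin 3) (Fin 3) K) - 1) ^ 2)).restrictScalars 𝒪[K]) ≤ scaleLattice (ϖ ^ (2 * dep w + 1)) w.1) ∧ (rk w = 2 ↔ ¬ w.1.map ((Matrix.toLin' ((((γ : GL (Fin 3) K) : Matrix (Fin 3) (Fin 3) K) - 1) ^ 2)).restrictScalars 𝒪[K]) ≤ scaleLattice (ϖ ^ (2 * dep w + 1)) w.1) := by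
  have h := hrk w
  by_cases hc : w.1.map ((Matrix.toLin' ((((γ : GL (Fin 3) K) : Matrix (Fin 3) (Fin 3) K) - 1) ^ 2)).restrictScalars 𝒪[K]) ≤ scaleLattice (ϖ ^ (2 * dep w + 1)) w.1
  · rw [if_pos hc] at h; exact ⟨⟨fun _ => hc, fun _ => h⟩, ⟨fun h2 => by omega, fun hn => absurd hc hn⟩⟩
  · rw [if_neg hc] at h; exact ⟨⟨fun h1 => by omega, fun hy => absurd hy hc⟩, ⟨fun _ => hc, fun _ => h⟩⟩

/-- The class label: `cl w = 1 ↔ CLS[w](dep w)(c₁)`, `cl w = −1 ↔ ¬ …`, and `cl w = 1 ∨ cl w = −1`. [cite: Kottwitz1986, §3] -/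
theorem cl_eq_one_iff_of_hcl {γ : unitaryGroupOfForm σ ((StdForm.antidiagonal 3).over K)} {dep : {M : Submodule 𝒪[K] (Fin 3 → K) // IsVertex σ ϖ ((StdForm.antidiagonal 3).over K) M} → ℕ} {cl : {M : Submodule 𝒪[K] (Fin 3 → K) // IsVertex σ ϖ ((StdForm.antidiagonal 3).over K) M} → ℤ} {c₁ : K}
    (hcl : ∀ w : {M : Submodule 𝒪[K] (Fin 3 → K) // IsVertex σ ϖ ((StdForm.antidiagonal 3).over K) M}, cl w = if (∃ y ∈ w.1, ∃ a : K, Valued.v a = 1 ∧ Valued.v ((ϖ ^ (dep w))⁻¹ * pairing σ ((StdForm.antidiagonal 3).over K) y ((((γ : GL (Fin 3) K) : Matrix (Fin 3) (Fin 3) K) - 1) *ᵥ y) - (c₁) * a ^ 2) < 1) then (1 : ℤ) else -1) (w : {M : Submodule 𝒪[K] (Fin 3 → K) // IsVertex σ ϖ ((StdForm.antidiagonal 3).over K) M}) :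
    (cl w = 1 ↔ (∃ y ∈ w.1, ∃ a : K, Valued.v a = 1 ∧ Valued.v ((ϖ ^ (dep w))⁻¹ * pairing σ ((StdForm.antidiagonal 3).over K) y ((((γ : GL (Fin 3) K) : Matrix (Fin 3) (Fin 3) K) - 1) *ᵥ y) - (c₁) * a ^ 2) < 1)) ∧ (cl w = -1 ↔ ¬ (∃ y ∈ w.1, ∃ a : K, Valued.v a = 1 ∧ Valued.v ((ϖ ^ (dep w))⁻¹ * pairing σ ((StdForm.antidiagonal 3).over K) y ((((γ : GL (Fin 3) K) : Matrix (Fin 3) (Fin 3) K) - 1) *ᵥ y) - (c₁) * a ^ 2) < 1)) ∧ (cl w = 1 ∨ cl w = -1) := by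
  have h := hcl w
  by_cases hc : (∃ y ∈ w.1, ∃ a : K, Valued.v a = 1 ∧ Valued.v ((ϖ ^ (dep w))⁻¹ * pairing σ ((StdForm.antidiagonal 3).over K) y ((((γ : GL (Fin 3) K) : Matrix (Fin 3) (Fin 3) K) - 1) *ᵥ y) - (c₁) * a ^ 2) < 1)
  · rw [if_pos hc] at h; exact ⟨⟨fun _ => hc, fun _ => h⟩, ⟨fun h2 => by omega, fun hn => absurd hc hn⟩, Or.inl h⟩
  · rw [if_neg hc] at h; exact ⟨⟨fun h1 => by omega, fun hy => absurd hy hc⟩, ⟨fun _ => hc, fun _ => h⟩, Or.inr h⟩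

/-- **RESIDUAL NILPOTENCY AT EVERY FIXED VERTEX OF DEPTH `d < N`** (★ ROW-N over ★ `charpoly_of_eigenframe`): `γ = A·diag(s)·A⁻¹` with `s 1 = 1`,
`|s 0 − 1| = |s 2 − 1| = |ϖ|^N`, and `LEV[w](ϖ^d)` with `d + 1 ≤ N` give `LEV₃[w](ϖ^(3d+1))`. [cite: Kottwitz1986, §3] [cite: Rogawski1990, §4.9 pp. 54–56] -/
theorem lev₃_of_lev_of_eigenframe (hϖ : Valued.v ϖ = WithZero.exp (-1 : ℤ)) {γ : unitaryGroupOfForm σ ((StdForm.antidiagonal 3).over K)} (hγ0 : γ ∈ unitaryInt σ ((StdForm.antidiagonal 3).over K))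
    (A : GL (Fin 3) K) (s : Fin 3 → K) (hs1 : s 1 = 1)
    (hγA : ((γ : GL (Fin 3) K) : Matrix (Fin 3) (Fin 3) K) = (A : Matrix (Fin 3) (Fin 3) K) * Matrix.diagonal s * ((A⁻¹ : GL (Fin 3) K) : Matrix (Fin 3) (Fin 3) K))
    {N : ℕ} (hs0 : Valued.v (s 0 - 1) = Valued.v ϖ ^ N) (hs2 : Valued.v (s 2 - 1) = Valued.v ϖ ^ N)
    (w : {M : Submodule 𝒪[K] (Fin 3 → K) // IsVertex σ ϖ ((StdForm.antidiagonal 3).over K) M}) {d : ℕ} (hdN : d + 1 ≤ N) (hlev : w.1.map ((Matrix.toLin' (((γ : GL (Fin 3) K) : Matrix (Fin 3) (Fin 3) K) - 1)).restrictScalars 𝒪[K]) ≤ scaleLattice (ϖ ^ d) w.1) : w.1.map ((Matrix.toLin' ((((γ : GL (Fin 3) K) : Matrix (Fin 3) (Fin 3) K) - 1) ^ 3)).restrictScalars 𝒪[K]) ≤ scaleLattice (ϖ ^ (3 * d + 1)) w.1 := by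
  have hϖ1 : Valued.v ϖ ≤ 1 := by rw [hϖ, ← WithZero.exp_zero]; exact WithZero.exp_le_exp.2 (by norm_num)
  have hle : Valued.v ϖ ^ N ≤ Valued.v ϖ ^ (d + 1) := pow_le_pow_right_of_le_one' hϖ1 hdN
  exact map_sub_one_pow_three_le_scaleLattice_of_charpoly_antidiagonal hϖ hγ0 (charpoly_of_eigenframe A s hs1 hγA) (hs0.le.trans hle) (hs2.le.trans hle) w hlev

/-- The engine's grandchildren binder `GC` (membership spelt with `∈ {v | γ·v = v}`) is the rows' explicit set. [cite: Serre1980Trees, II.1.1] -/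
theorem gc_eq_rowSet (hϖ : Valued.v ϖ = WithZero.exp (-1 : ℤ)) {γ : unitaryGroupOfForm σ ((StdForm.antidiagonal 3).over K)}
    (GC : {M : Submodule 𝒪[K] (Fin 3 → K) // IsVertex σ ϖ ((StdForm.antidiagonal 3).over K) M} → Set {M : Submodule 𝒪[K] (Fin 3 → K) // IsVertex σ ϖ ((StdForm.antidiagonal 3).over K) M}) (hGC : ∀ v w, w ∈ GC v ↔ ∃ c, ((latticeGraph σ ϖ ((StdForm.antidiagonal 3).over K)).Adj v c ∧ (latticeGraph σ ϖ ((StdForm.antidiagonal 3).over K)).dist ⟨stdLattice K 3, 0, isSelfDualLattice_stdLattice_three_of_v hϖ⟩ c = (latticeGraph σ ϖ ((StdForm.antidiagonal 3).over K)).dist ⟨stdLattice K 3, 0, isSelfDualLattice_stdLattice_three_of_v hϖ⟩ v + 1 ∧ c ∈ {v | latticeGraphIso σ ϖ ((StdForm.antidiagonal 3).over K) γ v = v}) ∧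
      ((latticeGraph σ ϖ ((StdForm.antidiagonal 3).over K)).Adj c w ∧ (latticeGraph σ ϖ ((StdForm.antidiagonal 3).over K)).dist ⟨stdLattice K 3, 0, isSelfDualLattice_stdLattice_three_of_v hϖ⟩ w = (latticeGraph σ ϖ ((StdForm.antidiagonal 3).over K)).dist ⟨stdLattice K 3, 0, isSelfDualLattice_stdLattice_three_of_v hϖ⟩ c + 1 ∧ w ∈ {v | latticeGraphIso σ ϖ ((StdForm.antidiagonal 3).over K) γ v = v})) (v : {M : Submodule 𝒪[K] (Fin 3 → K) // IsVertex σ ϖ ((StdForm.antidiagonal 3).over K) M}) :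
    GC v = {w | ∃ c, ((latticeGraph σ ϖ ((StdForm.antidiagonal 3).over K)).Adj v c ∧ (latticeGraph σ ϖ ((StdForm.antidiagonal 3).over K)).dist ⟨stdLattice K 3, 0, isSelfDualLattice_stdLattice_three_of_v hϖ⟩ c = (latticeGraph σ ϖ ((StdForm.antidiagonal 3).over K)).dist ⟨stdLattice K 3, 0, isSelfDualLattice_stdLattice_three_of_v hϖ⟩ v + 1 ∧ latticeGraphIso σ ϖ ((StdForm.antidiagonal 3).over K) γ c = c) ∧ ((latticeGraph σ ϖ ((StdForm.antidiagonal 3).over K)).Adj c w ∧ (latticeGraph σ ϖ ((StdForm.antidiagonal 3).over K)).dist ⟨stdLattice K 3, 0, isSelfDualLattice_stdLattice_three_of_v hϖ⟩ w = (latticeGraph σ ϖ ((StdForm.antidiagonal 3).over K)).dist ⟨stdLattice K 3, 0, isSelfDualLattice_stdLattice_three_of_v hϖ⟩ c + 1 ∧ latticeGraphIso σ ϖ ((StdForm.antidiagonal 3).over K) γ w = w)} :=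
  Set.ext fun w => hGC v w

/-- A member of `GC v` is `γ`-fixed. [cite: Serre1980Trees, II.1.1] -/
theorem fix_of_mem_gc (hϖ : Valued.v ϖ = WithZero.exp (-1 : ℤ)) {γ : unitaryGroupOfForm σ ((StdForm.antidiagonal 3).over K)}
    (GC : {M : Submodule 𝒪[K] (Fin 3 → K) // IsVertex σ ϖ ((StdForm.antidiagonal 3).over K) M} → Set {M : Submodule 𝒪[K] (Fin 3 → K) // IsVertex σ ϖ ((StdForm.antidiagonal 3).over K) M}) (hGC : ∀ v w, w ∈ GC v ↔ ∃ c, ((latticeGraph σ ϖ ((StdForm.antidiagonal 3).over K)).Adj v c ∧ (latticeGraph σ ϖ ((StdForm.antidiagonal 3).over K)).dist ⟨stdLattice K 3, 0, isSelfDualLattice_stdLattice_three_of_v hϖ⟩ c = (latticeGraph σ ϖ ((StdForm.antidiagonal 3).over K)).dist ⟨stdLattice K 3, 0, isSelfDualLattice_stdLattice_three_of_v hϖ⟩ v + 1 ∧ c ∈ {v | latticeGraphIso σ ϖ ((StdForm.antidiagonal 3).over K) γ v = v}) ∧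
      ((latticeGraph σ ϖ ((StdForm.antidiagonal 3).over K)).Adj c w ∧ (latticeGraph σ ϖ ((StdForm.antidiagonal 3).over K)).dist ⟨stdLattice K 3, 0, isSelfDualLattice_stdLattice_three_of_v hϖ⟩ w = (latticeGraph σ ϖ ((StdForm.antidiagonal 3).over K)).dist ⟨stdLattice K 3, 0, isSelfDualLattice_stdLattice_three_of_v hϖ⟩ c + 1 ∧ w ∈ {v | latticeGraphIso σ ϖ ((StdForm.antidiagonal 3).over K) γ v = v})) {v w : {M : Submodule 𝒪[K] (Fin 3 → K) // IsVertex σ ϖ ((StdForm.antidiagonal 3).over K) M}} (hw : w ∈ GC v) : latticeGraphIso σ ϖ ((StdForm.antidiagonal 3).over K) γ w = w := by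
  obtain ⟨c, -, -, -, hwf⟩ := (hGC v w).1 hw
  exact hwf

/-! ## §2 The rows `hodd`, `hC`, `hR`, `hE` of the engine -/

/-- **`hodd`: a fixed self-dual vertex of depth `≥ 2` and rank one has ODD depth** (★ I: at even depth `d` with `LEV₂(ϖ^(2d+1))` the level rises to `ϖ^(d+1)`, against
`dep v = d < N`). [cite: Kottwitz1986, §3] [cite: Rogawski1990, §4.9 pp. 54–56] -/
theorem engineRow_odd (hσ : ∀ x, σ (σ x) = x) (hvσ : ∀ a, Valued.v (σ a) = Valued.v a) (hσϖ : σ ϖ = -ϖ)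
    (hϖ : Valued.v ϖ = WithZero.exp (-1 : ℤ)) (hres : ∀ x : K, Valued.v x ≤ 1 → Valued.v (σ x - x) < 1) (h2 : Valued.v (2 : K) = 1) [Finite 𝓀[K]]
    {γ : unitaryGroupOfForm σ ((StdForm.antidiagonal 3).over K)}
    {N : ℕ}
    (B : ℕ) (dep rk : {M : Submodule 𝒪[K] (Fin 3 → K) // IsVertex σ ϖ ((StdForm.antidiagonal 3).over K) M} → ℕ)
    (hdep : ∀ w : {M : Submodule 𝒪[K] (Fin 3 → K) // IsVertex σ ϖ ((StdForm.antidiagonal 3).over K) M}, latticeGraphIso σ ϖ ((StdForm.antidiagonal 3).over K) γ w = w → ∀ e, e ≤ dep w ↔ e ≤ B ∧ w.1.map ((Matrix.toLin' (((γ : GL (Fin 3) K) : Matrix (Fin 3) (Fin 3) K) - 1)).restrictScalars 𝒪[K]) ≤ scaleLattice (ϖ ^ e) w.1)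
    (hrk : ∀ w : {M : Submodule 𝒪[K] (Fin 3 → K) // IsVertex σ ϖ ((StdForm.antidiagonal 3).over K) M}, rk w = if w.1.map ((Matrix.toLin' ((((γ : GL (Fin 3) K) : Matrix (Fin 3) (Fin 3) K) - 1) ^ 2)).restrictScalars 𝒪[K]) ≤ scaleLattice (ϖ ^ (2 * dep w + 1)) w.1 then 1 else 2)
    (hBN : B = N)
    (horient : ∀ v : {M : Submodule 𝒪[K] (Fin 3 → K) // IsVertex σ ϖ ((StdForm.antidiagonal 3).over K) M}, IsSelfDualLattice σ ϖ ((StdForm.antidiagonal 3).over K) v.1 → v ≠ ⟨stdLattice K 3, 0, isSelfDualLattice_stdLattice_three_of_v hϖ⟩ → latticeGraphIso σ ϖ ((StdForm.antidiagonal 3).over K) γ v = v →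
      dep v < N ∧ ∃ p g : {M : Submodule 𝒪[K] (Fin 3 → K) // IsVertex σ ϖ ((StdForm.antidiagonal 3).over K) M}, (latticeGraph σ ϖ ((StdForm.antidiagonal 3).over K)).Adj v p ∧ (latticeGraph σ ϖ ((StdForm.antidiagonal 3).over K)).dist ⟨stdLattice K 3, 0, isSelfDualLattice_stdLattice_three_of_v hϖ⟩ p + 1 = (latticeGraph σ ϖ ((StdForm.antidiagonal 3).over K)).dist ⟨stdLattice K 3, 0, isSelfDualLattice_stdLattice_three_of_v hϖ⟩ v ∧ (latticeGraph σ ϖ ((StdForm.antidiagonal 3).over K)).Adj p g ∧ g ≠ v ∧ g.1.map ((Matrix.toLin' (((γ : GL (Fin 3) K) : Matrix (Fin 3) (Fin 3) K) - 1)).restrictScalars 𝒪[K]) ≤ scaleLattice (ϖ ^ dep v) g.1)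
    (v : {M : Submodule 𝒪[K] (Fin 3 → K) // IsVertex σ ϖ ((StdForm.antidiagonal 3).over K) M}) (hvF : v ∈ {v : {M : Submodule 𝒪[K] (Fin 3 → K) // IsVertex σ ϖ ((StdForm.antidiagonal 3).over K) M} | latticeGraphIso σ ϖ ((StdForm.antidiagonal 3).over K) γ v = v}) (hv : IsSelfDualLattice σ ϖ ((StdForm.antidiagonal 3).over K) v.1) (hvr : v ≠ ⟨stdLattice K 3, 0, isSelfDualLattice_stdLattice_three_of_v hϖ⟩) (h2d : 2 ≤ dep v) (hrk1 : rk v = 1) :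
    Odd (dep v) := by
  have hfix : latticeGraphIso σ ϖ ((StdForm.antidiagonal 3).over K) γ v = v := hvF
  by_contra hodd
  rw [Nat.not_odd_iff_even] at hodd
  obtain ⟨hdN, -⟩ := horient v hv hvr hfix
  obtain ⟨u, hu⟩ := exists_latticeGraphIso_root_eq_of_v_two hσ hvσ hϖ h2 v hv (isSelfDualLattice_stdLattice_three_of_v hϖ)
  have hv1 : v.1 = latt ((u : GL (Fin 3) K) : Matrix (Fin 3) (Fin 3) K) := by rw [← hu, latticeGraphIso_apply_val]; rfl
  have hlev := lev_pow_of_le_dep hdep hfix le_rfl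
  have hlev₂ := ((rk_eq_one_iff_of_hrk hrk v).1).1 hrk1
  rw [hv1] at hlev hlev₂
  have h := map_sub_one_latt_le_scaleLattice_succ_of_even hvσ hσϖ hϖ hres h2 u γ hodd (by omega) hlev hlev₂
  rw [← hv1] at h
  exact not_lev_pow_of_dep_lt hdep hfix (by omega) (Nat.lt_succ_self _) h

/-- **`hC`: a fixed self-dual vertex of depth `1` and rank `1` has no fixed grandchildren** (★ ROW-C). [cite: Kottwitz1986, §3] [cite: BruhatTits1972, §10] -/
theorem engineRow_C (hσ : ∀ x, σ (σ x) = x) (hvσ : ∀ a, Valued.v (σ a) = Valued.v a) (hσϖ : σ ϖ = -ϖ)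
    (hϖ : Valued.v ϖ = WithZero.exp (-1 : ℤ)) (hres : ∀ x : K, Valued.v x ≤ 1 → Valued.v (σ x - x) < 1) (h2 : Valued.v (2 : K) = 1) [Finite 𝓀[K]]
    (hT : (latticeGraph σ ϖ ((StdForm.antidiagonal 3).over K)).IsTree)
    {γ : unitaryGroupOfForm σ ((StdForm.antidiagonal 3).over K)} (hγ0 : γ ∈ unitaryInt σ ((StdForm.antidiagonal 3).over K))
    (A : GL (Fin 3) K) (s : Fin 3 → K) (hs1 : s 1 = 1)
    (hγA : ((γ : GL (Fin 3) K) : Matrix (Fin 3) (Fin 3) K) = (A : Matrix (Fin 3) (Fin 3) K) * Matrix.diagonal s * ((A⁻¹ : GL (Fin 3) K) : Matrix (Fin 3) (Fin 3) K))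
    {N : ℕ} (hs0 : Valued.v (s 0 - 1) = Valued.v ϖ ^ N) (hs2 : Valued.v (s 2 - 1) = Valued.v ϖ ^ N) (hN3 : 3 ≤ N)
    (B : ℕ) (dep rk : {M : Submodule 𝒪[K] (Fin 3 → K) // IsVertex σ ϖ ((StdForm.antidiagonal 3).over K) M} → ℕ)
    (hdep : ∀ w : {M : Submodule 𝒪[K] (Fin 3 → K) // IsVertex σ ϖ ((StdForm.antidiagonal 3).over K) M}, latticeGraphIso σ ϖ ((StdForm.antidiagonal 3).over K) γ w = w → ∀ e, e ≤ dep w ↔ e ≤ B ∧ w.1.map ((Matrix.toLin' (((γ : GL (Fin 3) K) : Matrix (Fin 3) (Fin 3) K) - 1)).restrictScalars 𝒪[K]) ≤ scaleLattice (ϖ ^ e) w.1)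
    (hrk : ∀ w : {M : Submodule 𝒪[K] (Fin 3 → K) // IsVertex σ ϖ ((StdForm.antidiagonal 3).over K) M}, rk w = if w.1.map ((Matrix.toLin' ((((γ : GL (Fin 3) K) : Matrix (Fin 3) (Fin 3) K) - 1) ^ 2)).restrictScalars 𝒪[K]) ≤ scaleLattice (ϖ ^ (2 * dep w + 1)) w.1 then 1 else 2)
    (hBN : B = N)
    (GC : {M : Submodule 𝒪[K] (Fin 3 → K) // IsVertex σ ϖ ((StdForm.antidiagonal 3).over K) M} → Set {M : Submodule 𝒪[K] (Fin 3 → K) // IsVertex σ ϖ ((StdForm.antidiagonal 3).over K) M}) (hGC : ∀ v w, w ∈ GC v ↔ ∃ c, ((latticeGraph σ ϖ ((StdForm.antidiagonal 3).over K)).Adj v c ∧ (latticeGraph σ ϖ ((StdForm.antidiagonal 3).over K)).dist ⟨stdLattice K 3, 0, isSelfDualLattice_stdLattice_three_of_v hϖ⟩ c = (latticeGraph σ ϖ ((StdForm.antidiagonal 3).over K)).dist ⟨stdLattice K 3, 0, isSelfDualLattice_stdLattice_three_of_v hϖ⟩ v + 1 ∧ c ∈ {v | latticeGraphIso σ ϖ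 ((StdForm.antidiagonal 3).over K) γ v = v}) ∧
      ((latticeGraph σ ϖ ((StdForm.antidiagonal 3).over K)).Adj c w ∧ (latticeGraph σ ϖ ((StdForm.antidiagonal 3).over K)).dist ⟨stdLattice K 3, 0, isSelfDualLattice_stdLattice_three_of_v hϖ⟩ w = (latticeGraph σ ϖ ((StdForm.antidiagonal 3).over K)).dist ⟨stdLattice K 3, 0, isSelfDualLattice_stdLattice_three_of_v hϖ⟩ c + 1 ∧ w ∈ {v | latticeGraphIso σ ϖ ((StdForm.antidiagonal 3).over K) γ v = v}))
    (horient : ∀ v : {M : Submodule 𝒪[K] (Fin 3 → K) // IsVertex σ ϖ ((StdForm.antidiagonal 3).over K) M}, IsSelfDualLattice σ ϖ ((StdForm.antidiagonal 3).over K) v.1 → v ≠ ⟨stdLattice K 3, 0, isSelfDualLattice_stdLattice_three_of_v hϖ⟩ → latticeGraphIso σ ϖ ((StdForm.antidiagonal 3).over K) γ v = v →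
      dep v < N ∧ ∃ p g : {M : Submodule 𝒪[K] (Fin 3 → K) // IsVertex σ ϖ ((StdForm.antidiagonal 3).over K) M}, (latticeGraph σ ϖ ((StdForm.antidiagonal 3).over K)).Adj v p ∧ (latticeGraph σ ϖ ((StdForm.antidiagonal 3).over K)).dist ⟨stdLattice K 3, 0, isSelfDualLattice_stdLattice_three_of_v hϖ⟩ p + 1 = (latticeGraph σ ϖ ((StdForm.antidiagonal 3).over K)).dist ⟨stdLattice K 3, 0, isSelfDualLattice_stdLattice_three_of_v hϖ⟩ v ∧ (latticeGraph σ ϖ ((StdForm.antidiagonal 3).over K)).Adj p g ∧ g ≠ v ∧ g.1.map ((Matrix.toLin' (((γ : GL (Fin 3) K) : Matrix (Fin 3) (Fin 3) K) - 1)).restrictScalars 𝒪[K]) ≤ scaleLattice (ϖ ^ dep v) g.1)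
    (v : {M : Submodule 𝒪[K] (Fin 3 → K) // IsVertex σ ϖ ((StdForm.antidiagonal 3).over K) M}) (hvF : v ∈ {v : {M : Submodule 𝒪[K] (Fin 3 → K) // IsVertex σ ϖ ((StdForm.antidiagonal 3).over K) M} | latticeGraphIso σ ϖ ((StdForm.antidiagonal 3).over K) γ v = v}) (hv : IsSelfDualLattice σ ϖ ((StdForm.antidiagonal 3).over K) v.1) (hvr : v ≠ ⟨stdLattice K 3, 0, isSelfDualLattice_stdLattice_three_of_v hϖ⟩) (hd1 : dep v = 1) (hrk1 : rk v = 1) :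
    GC v = ∅ := by
  have hfix : latticeGraphIso σ ϖ ((StdForm.antidiagonal 3).over K) γ v = v := hvF
  obtain ⟨-, p, g, hp, hpin, hg, hgv, hup⟩ := horient v hv hvr hfix
  rw [hd1, pow_one] at hup
  have hlev := lev_pow_of_le_dep hdep hfix (le_of_eq hd1.symm)
  rw [pow_one] at hlev
  have hexact := not_lev_pow_of_dep_lt hdep hfix (show 2 ≤ B by omega) (by omega : dep v < 2)
  have hrk' := ((rk_eq_one_iff_of_hrk hrk v).1).1 hrk1
  rw [hd1] at hrk'
  have hnil := lev₃_of_lev_of_eigenframe hϖ hγ0 A s hs1 hγA hs0 hs2 v (by omega : 1 + 1 ≤ N) (by rw [pow_one]; exact hlev)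
  rw [gc_eq_rowSet hϖ GC hGC v]
  exact fixedGrandchildren_eq_empty_of_rankOne_depthOne hσ hvσ hσϖ hϖ hres h2 hT hγ0 hv hvr hfix hp hpin hg hgv hup hlev hexact hrk' hnil

/-- **`hR`: a REGULAR fixed self-dual vertex of depth `1` has `q` fixed grandchildren, all of depth `0`** (★ ROW-R). [cite: Kottwitz1986, §3] [cite: BruhatTits1972, §10] -/
theorem engineRow_R (hσ : ∀ x, σ (σ x) = x) (hvσ : ∀ a, Valued.v (σ a) = Valued.v a) (hσϖ : σ ϖ = -ϖ)
    (hϖ : Valued.v ϖ = WithZero.exp (-1 : ℤ)) (hres : ∀ x : K, Valued.v x ≤ 1 → Valued.v (σ x - x) < 1) (h2 : Valued.v (2 : K) = 1) [Finite 𝓀[K]]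
    (hT : (latticeGraph σ ϖ ((StdForm.antidiagonal 3).over K)).IsTree)
    {γ : unitaryGroupOfForm σ ((StdForm.antidiagonal 3).over K)} (hγ0 : γ ∈ unitaryInt σ ((StdForm.antidiagonal 3).over K))
    (A : GL (Fin 3) K) (s : Fin 3 → K) (hs1 : s 1 = 1)
    (hγA : ((γ : GL (Fin 3) K) : Matrix (Fin 3) (Fin 3) K) = (A : Matrix (Fin 3) (Fin 3) K) * Matrix.diagonal s * ((A⁻¹ : GL (Fin 3) K) : Matrix (Fin 3) (Fin 3) K))
    {N : ℕ} (hs0 : Valued.v (s 0 - 1) = Valued.v ϖ ^ N) (hs2 : Valued.v (s 2 - 1) = Valued.v ϖ ^ N) (hN3 : 3 ≤ N)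
    (B : ℕ) (dep rk : {M : Submodule 𝒪[K] (Fin 3 → K) // IsVertex σ ϖ ((StdForm.antidiagonal 3).over K) M} → ℕ)
    (hdep : ∀ w : {M : Submodule 𝒪[K] (Fin 3 → K) // IsVertex σ ϖ ((StdForm.antidiagonal 3).over K) M}, latticeGraphIso σ ϖ ((StdForm.antidiagonal 3).over K) γ w = w → ∀ e, e ≤ dep w ↔ e ≤ B ∧ w.1.map ((Matrix.toLin' (((γ : GL (Fin 3) K) : Matrix (Fin 3) (Fin 3) K) - 1)).restrictScalars 𝒪[K]) ≤ scaleLattice (ϖ ^ e) w.1)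
    (hrk : ∀ w : {M : Submodule 𝒪[K] (Fin 3 → K) // IsVertex σ ϖ ((StdForm.antidiagonal 3).over K) M}, rk w = if w.1.map ((Matrix.toLin' ((((γ : GL (Fin 3) K) : Matrix (Fin 3) (Fin 3) K) - 1) ^ 2)).restrictScalars 𝒪[K]) ≤ scaleLattice (ϖ ^ (2 * dep w + 1)) w.1 then 1 else 2)
    (hBN : B = N)
    (GC : {M : Submodule 𝒪[K] (Fin 3 → K) // IsVertex σ ϖ ((StdForm.antidiagonal 3).over K) M} → Set {M : Submodule 𝒪[K] (Fin 3 → K) // IsVertex σ ϖ ((StdForm.antidiagonal 3).over K) M}) (hGC : ∀ v w, w ∈ GC v ↔ ∃ c, ((latticeGraph σ ϖ ((StdForm.antidiagonal 3).over K)).Adj v c ∧ (latticeGraph σ ϖ ((StdForm.antidiagonal 3).over K)).dist ⟨stdLattice K 3, 0, isSelfDualLattice_stdLattice_three_of_v hϖ⟩ c = (latticeGraph σ ϖ ((StdForm.antidiagonal 3).over K)).dist ⟨stdLattice K 3, 0, isSelfDualLattice_stdLattice_three_of_v hϖ⟩ v + 1 ∧ c ∈ {v | latticeGraphIso σ ϖ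 ((StdForm.antidiagonal 3).over K) γ v = v}) ∧
      ((latticeGraph σ ϖ ((StdForm.antidiagonal 3).over K)).Adj c w ∧ (latticeGraph σ ϖ ((StdForm.antidiagonal 3).over K)).dist ⟨stdLattice K 3, 0, isSelfDualLattice_stdLattice_three_of_v hϖ⟩ w = (latticeGraph σ ϖ ((StdForm.antidiagonal 3).over K)).dist ⟨stdLattice K 3, 0, isSelfDualLattice_stdLattice_three_of_v hϖ⟩ c + 1 ∧ w ∈ {v | latticeGraphIso σ ϖ ((StdForm.antidiagonal 3).over K) γ v = v}))
    (q : ℕ) (hq : q = Nat.card 𝓀[K])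
    (horient : ∀ v : {M : Submodule 𝒪[K] (Fin 3 → K) // IsVertex σ ϖ ((StdForm.antidiagonal 3).over K) M}, IsSelfDualLattice σ ϖ ((StdForm.antidiagonal 3).over K) v.1 → v ≠ ⟨stdLattice K 3, 0, isSelfDualLattice_stdLattice_three_of_v hϖ⟩ → latticeGraphIso σ ϖ ((StdForm.antidiagonal 3).over K) γ v = v →
      dep v < N ∧ ∃ p g : {M : Submodule 𝒪[K] (Fin 3 → K) // IsVertex σ ϖ ((StdForm.antidiagonal 3).over K) M}, (latticeGraph σ ϖ ((StdForm.antidiagonal 3).over K)).Adj v p ∧ (latticeGraph σ ϖ ((StdForm.antidiagonal 3).over K)).dist ⟨stdLattice K 3, 0, isSelfDualLattice_stdLattice_three_of_v hϖ⟩ p + 1 = (latticeGraph σ ϖ ((StdForm.antidiagonal 3).over K)).dist ⟨stdLattice K 3, 0, isSelfDualLattice_stdLattice_three_of_v hϖ⟩ v ∧ (latticeGraph σ ϖ ((StdForm.antidiagonal 3).over K)).Adj p g ∧ g ≠ v ∧ g.1.map ((Matrix.toLin' (((γ : GL (Fin 3) K) : Matrix (Fin 3) (Fin 3) K) - 1)).restrictScalars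 𝒪[K]) ≤ scaleLattice (ϖ ^ dep v) g.1)
    (v : {M : Submodule 𝒪[K] (Fin 3 → K) // IsVertex σ ϖ ((StdForm.antidiagonal 3).over K) M}) (hvF : v ∈ {v : {M : Submodule 𝒪[K] (Fin 3 → K) // IsVertex σ ϖ ((StdForm.antidiagonal 3).over K) M} | latticeGraphIso σ ϖ ((StdForm.antidiagonal 3).over K) γ v = v}) (hv : IsSelfDualLattice σ ϖ ((StdForm.antidiagonal 3).over K) v.1) (hvr : v ≠ ⟨stdLattice K 3, 0, isSelfDualLattice_stdLattice_three_of_v hϖ⟩) (hd1 : dep v = 1) (hrk2 : rk v = 2) :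
    (∀ w ∈ GC v, dep w = 0) ∧ (GC v).ncard = q := by
  have hfix : latticeGraphIso σ ϖ ((StdForm.antidiagonal 3).over K) γ v = v := hvF
  obtain ⟨-, p, g, hp, hpin, hg, hgv, hup⟩ := horient v hv hvr hfix
  rw [hd1, pow_one] at hup
  have hlev := lev_pow_of_le_dep hdep hfix (le_of_eq hd1.symm)
  rw [pow_one] at hlev
  have hlev2 := not_lev_pow_of_dep_lt hdep hfix (show 2 ≤ B by omega) (by omega : dep v < 2)
  have hrk' := ((rk_eq_one_iff_of_hrk hrk v).2).1 hrk2
  rw [hd1] at hrk'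
  have hnil := lev₃_of_lev_of_eigenframe hϖ hγ0 A s hs1 hγA hs0 hs2 v (by omega : 1 + 1 ≤ N) (by rw [pow_one]; exact hlev)
  obtain ⟨hall, hcard⟩ := fixedGrandchildren_not_lev_and_ncard_of_regular_one hσ hvσ hσϖ hϖ hres h2 hT hγ0 hv hvr hfix hp hpin hg hgv hup hlev hlev2 hrk' hnil
  rw [gc_eq_rowSet hϖ GC hGC v, hq]
  refine ⟨fun w hw => ?_, hcard⟩
  have hwfix : latticeGraphIso σ ϖ ((StdForm.antidiagonal 3).over K) γ w = w := by obtain ⟨c, -, -, -, hwf⟩ := hw; exact hwf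
  have hn := hall w hw
  by_contra h0
  exact hn (by have := lev_pow_of_le_dep hdep hwfix (show 1 ≤ dep w by omega); rwa [pow_one] at this)

/-- **`hE`: an EVEN fixed self-dual vertex (depth `2m+2`, rank `2`) has `q²` fixed grandchildren, all `(2m+1, rank 2)`** (★ ROW-E). [cite: Kottwitz1986, §3] [cite: Rogawski1990, §4.9 pp. 54–56] -/
theorem engineRow_E (hσ : ∀ x, σ (σ x) = x) (hvσ : ∀ a, Valued.v (σ a) = Valued.v a) (hσϖ : σ ϖ = -ϖ)
    (hϖ : Valued.v ϖ = WithZero.exp (-1 : ℤ)) (hres : ∀ x : K, Valued.v x ≤ 1 → Valued.v (σ x - x) < 1) (h2 : Valued.v (2 : K) = 1) [Finite 𝓀[K]]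
    (hT : (latticeGraph σ ϖ ((StdForm.antidiagonal 3).over K)).IsTree)
    {γ : unitaryGroupOfForm σ ((StdForm.antidiagonal 3).over K)} (hγ0 : γ ∈ unitaryInt σ ((StdForm.antidiagonal 3).over K))
    (A : GL (Fin 3) K) (s : Fin 3 → K) (hs1 : s 1 = 1)
    (hγA : ((γ : GL (Fin 3) K) : Matrix (Fin 3) (Fin 3) K) = (A : Matrix (Fin 3) (Fin 3) K) * Matrix.diagonal s * ((A⁻¹ : GL (Fin 3) K) : Matrix (Fin 3) (Fin 3) K))
    {N : ℕ} (hs0 : Valued.v (s 0 - 1) = Valued.v ϖ ^ N) (hs2 : Valued.v (s 2 - 1) = Valued.v ϖ ^ N)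
    (B : ℕ) (dep rk : {M : Submodule 𝒪[K] (Fin 3 → K) // IsVertex σ ϖ ((StdForm.antidiagonal 3).over K) M} → ℕ)
    (hdep : ∀ w : {M : Submodule 𝒪[K] (Fin 3 → K) // IsVertex σ ϖ ((StdForm.antidiagonal 3).over K) M}, latticeGraphIso σ ϖ ((StdForm.antidiagonal 3).over K) γ w = w → ∀ e, e ≤ dep w ↔ e ≤ B ∧ w.1.map ((Matrix.toLin' (((γ : GL (Fin 3) K) : Matrix (Fin 3) (Fin 3) K) - 1)).restrictScalars 𝒪[K]) ≤ scaleLattice (ϖ ^ e) w.1)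
    (hrk : ∀ w : {M : Submodule 𝒪[K] (Fin 3 → K) // IsVertex σ ϖ ((StdForm.antidiagonal 3).over K) M}, rk w = if w.1.map ((Matrix.toLin' ((((γ : GL (Fin 3) K) : Matrix (Fin 3) (Fin 3) K) - 1) ^ 2)).restrictScalars 𝒪[K]) ≤ scaleLattice (ϖ ^ (2 * dep w + 1)) w.1 then 1 else 2)
    (hBN : B = N)
    (GC : {M : Submodule 𝒪[K] (Fin 3 → K) // IsVertex σ ϖ ((StdForm.antidiagonal 3).over K) M} → Set {M : Submodule 𝒪[K] (Fin 3 → K) // IsVertex σ ϖ ((StdForm.antidiagonal 3).over K) M}) (hGC : ∀ v w, w ∈ GC v ↔ ∃ c, ((latticeGraph σ ϖ ((StdForm.antidiagonal 3).over K)).Adj v c ∧ (latticeGraph σ ϖ ((StdForm.antidiagonal 3).over K)).dist ⟨stdLattice K 3, 0, isSelfDualLattice_stdLattice_three_of_v hϖ⟩ c = (latticeGraph σ ϖ ((StdForm.antidiagonal 3).over K)).dist ⟨stdLattice K 3, 0, isSelfDualLattice_stdLattice_three_of_v hϖ⟩ v + 1 ∧ c ∈ {v | latticeGraphIso σ ϖ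 ((StdForm.antidiagonal 3).over K) γ v = v}) ∧
      ((latticeGraph σ ϖ ((StdForm.antidiagonal 3).over K)).Adj c w ∧ (latticeGraph σ ϖ ((StdForm.antidiagonal 3).over K)).dist ⟨stdLattice K 3, 0, isSelfDualLattice_stdLattice_three_of_v hϖ⟩ w = (latticeGraph σ ϖ ((StdForm.antidiagonal 3).over K)).dist ⟨stdLattice K 3, 0, isSelfDualLattice_stdLattice_three_of_v hϖ⟩ c + 1 ∧ w ∈ {v | latticeGraphIso σ ϖ ((StdForm.antidiagonal 3).over K) γ v = v}))
    (q : ℕ) (hq : q = Nat.card 𝓀[K])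
    (horient : ∀ v : {M : Submodule 𝒪[K] (Fin 3 → K) // IsVertex σ ϖ ((StdForm.antidiagonal 3).over K) M}, IsSelfDualLattice σ ϖ ((StdForm.antidiagonal 3).over K) v.1 → v ≠ ⟨stdLattice K 3, 0, isSelfDualLattice_stdLattice_three_of_v hϖ⟩ → latticeGraphIso σ ϖ ((StdForm.antidiagonal 3).over K) γ v = v →
      dep v < N ∧ ∃ p g : {M : Submodule 𝒪[K] (Fin 3 → K) // IsVertex σ ϖ ((StdForm.antidiagonal 3).over K) M}, (latticeGraph σ ϖ ((StdForm.antidiagonal 3).over K)).Adj v p ∧ (latticeGraph σ ϖ ((StdForm.antidiagonal 3).over K)).dist ⟨stdLattice K 3, 0, isSelfDualLattice_stdLattice_three_of_v hϖ⟩ p + 1 = (latticeGraph σ ϖ ((StdForm.antidiagonal 3).over K)).dist ⟨stdLattice K 3, 0, isSelfDualLattice_stdLattice_three_of_v hϖ⟩ v ∧ (latticeGraph σ ϖ ((StdForm.antidiagonal 3).over K)).Adj p g ∧ g ≠ v ∧ g.1.map ((Matrix.toLin' (((γ : GL (Fin 3) K) : Matrix (Fin 3) (Fin 3) K) - 1)).restrictScalars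 𝒪[K]) ≤ scaleLattice (ϖ ^ dep v) g.1)
    (v : {M : Submodule 𝒪[K] (Fin 3 → K) // IsVertex σ ϖ ((StdForm.antidiagonal 3).over K) M}) (hvF : v ∈ {v : {M : Submodule 𝒪[K] (Fin 3 → K) // IsVertex σ ϖ ((StdForm.antidiagonal 3).over K) M} | latticeGraphIso σ ϖ ((StdForm.antidiagonal 3).over K) γ v = v}) (hv : IsSelfDualLattice σ ϖ ((StdForm.antidiagonal 3).over K) v.1) (hvr : v ≠ ⟨stdLattice K 3, 0, isSelfDualLattice_stdLattice_three_of_v hϖ⟩) (m : ℕ) (hdm : dep v = 2 * m + 2) (hrk2 : rk v = 2) :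
    (∀ w ∈ GC v, dep w = 2 * m + 1 ∧ rk w = 2) ∧ (GC v).ncard = q ^ 2 := by
  have hfix : latticeGraphIso σ ϖ ((StdForm.antidiagonal 3).over K) γ v = v := hvF
  obtain ⟨hdN, p, g, hp, hpin, hg, hgv, hup⟩ := horient v hv hvr hfix
  rw [hdm] at hup hdN
  have hlev := lev_pow_of_le_dep hdep hfix (le_of_eq hdm.symm)
  have hexact := not_lev_pow_of_dep_lt hdep hfix (show 2 * m + 2 + 1 ≤ B by omega) (by omega : dep v < 2 * m + 2 + 1)
  have hrk' := ((rk_eq_one_iff_of_hrk hrk v).2).1 hrk2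
  rw [hdm] at hrk'
  have hnil := lev₃_of_lev_of_eigenframe hϖ hγ0 A s hs1 hγA hs0 hs2 v (by omega : 2 * m + 2 + 1 ≤ N) hlev
  obtain ⟨hall, hcard⟩ := fixedGrandchildren_tokens_and_ncard_of_even hσ hvσ hσϖ hϖ hres h2 hT hγ0 hv hvr hfix (by omega : 2 ≤ 2 * m + 2) ⟨m + 1, by ring⟩
    hp hpin hg hgv hup hlev hexact hrk' hnil
  rw [gc_eq_rowSet hϖ GC hGC v, hq]
  refine ⟨fun w hw => ?_, hcard⟩
  have hwfix : latticeGraphIso σ ϖ ((StdForm.antidiagonal 3).over K) γ w = w := by obtain ⟨c, -, -, -, hwf⟩ := hw; exact hwf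
  obtain ⟨hw1, hw2, hw3⟩ := hall w hw
  rw [show 2 * m + 2 - 1 = 2 * m + 1 by omega] at hw1
  rw [show 2 * (2 * m + 2) - 1 = 2 * (2 * m + 1) + 1 by omega] at hw3
  have hdw : dep w = 2 * m + 1 := dep_eq_of_lev_of_not_lev hdep hwfix (by omega) hw1 hw2
  refine ⟨hdw, ((rk_eq_one_iff_of_hrk hrk w).2).2 ?_⟩
  rw [hdw]; exact hw3

end Literature.NumberTheory.Automorphic.UnitaryLatticeTree

end
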